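import Summits.BirchSwinnertonDyer.Rank1Residual.Additive.CyclotomicThreeMultiplicativeReduction
import Literature.NumberTheory.EllipticCurves.PAdicHeightsLogProofs
import Mathlib.NumberTheory.NumberField.Cyclotomic.Ideal
import HarnessLib

/-!
# `K = ℚ(ζ₃)` at the prime above `3` for a curve with SPLIT multiplicative reduction at `3`: split stays
# split, `[K_𝔭 : ℚ₃] = 2` is prime to `3`, and `ord₃ log₃ γ_cyc = 1` (line V16 of the additive sub-cell)

HONEST FRAMING (cell `b2b-bsdres`, run/shared/lean/b2b/bsd-rank1-residual/, verbatim in every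
file): the goal of the cell is to DELETE the COMBINATION-SHAPED residual classes of the
Birch–Swinnerton-Dyer formula for ALL analytic-rank `≤ 1` elliptic curves over `ℚ` — "full BSD
formula for every rank `≤ 1` curve in class `C`" assembled STRICTLY from published theorems — so
that the rank-`≤ 1` remainder becomes exactly the CONSTRUCTION-SHAPED classes, which are TYPED
(missing-input `Prop`s), NOT attempted. This is not "finishing BSD". Seat additive-p4 (research route
on X3/X4), gen 6; no label is changed by this file; nothing is booked here.

Theorems only (no `def`, no `sorry`, no named fact). The three `K`-side / `3`-adic inputs of line V16
(the (M)-rows of X3/X4 at `p = 3` whose twist `V = W^{(−3)}` is SPLIT multiplicative at `3`), twin of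
`CyclotomicThreeMultiplicativeReduction` (non-split, line V15):

* `splits_nodal_of_hasSplitMultiplicativeReductionAtPrime`, `hasSplitMultiplicativeReductionAt_baseChange_of_split`
  — split multiplicative reduction of `V` at `3` passes to `V_K` at a place `𝔭 ∋ 3` of residue degree
  one (the node-tangent quadratic of `V_ℤ` splits over `𝔽₃ = k_𝔭`; model independence);
* `not_dvd_ramificationIdx_mul_inertiaDeg_cyclotomicThree` — for `K` cyclotomic `{3}`: `e(𝔭|3)·f(𝔭|3)
  = 2·1` is prime to `3` (Mathlib `IsCyclotomicExtension.Rat.ramificationIdx_eq_of_prime` /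
  `inertiaDeg_eq_of_prime`), the degree hypothesis of
  `Greenberg1999.thm41Analogue_charValue_rankZero_split_baseChange`;
* `valuation_padicLog_cyclotomicGenerator_three` — `ord₃ log₃(γ_cyc) = ord₃ log₃ 4 = 1` (the
  logarithmic series on `1 + 3ℤ₃` preserves the norm: tree `norm_padicLogSeries_eq`), the `3⁻¹` of the
  Greenberg–Stevens derivative `[T¹]L₃(V,T)·log₃ γ = 𝓛₃(V)·[0]⁺_f` that cancels the `2p` of Greenberg's
  `l_𝔭 = 𝓛₃(V)/(2·3)`.

References: Silverman *AEC* VII.5 Prop. 5.1(b), VII.1 Prop. 1.3(b) [SilvermanAEC2009]; Washington,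
*Cyclotomic Fields* §5.1 (the `p`-adic logarithm) [Washington1997]; Iwasawa 1972 §4.4.
-/

noncomputable section

open scoped Classical NumberField

open WeierstrassCurve NumberField IsDedekindDomain Rat.HeightOneSpectrum
  Literature.NumberTheory.EllipticCurves Literature.NumberTheory.EllipticCurves.Rank1Residual

namespace Summit.BirchSwinnertonDyer.Rank1Residual.Additive

/-! ## §1 Split multiplicative reduction passes to `V_K` at a degree-one prime -/

section Split

variable (V : WeierstrassCurve ℚ) [V.IsElliptic] [V.IsGloballyMinimal] (p : ℕ) [hp : Fact p.Prime]

/-- **Split multiplicative reduction at `p` read on `V_ℤ mod p`**: the node-tangent quadratic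
`c₄T² + a₁c₄T − (54b₆ − 3b₂b₄ + a₂c₄)` of `integralModelInt V` splits over `𝔽_p` (tree
`hasSplitMultiplicativeReductionAt_iff_splits` + the prime/place bridge).
[cite: SilvermanAEC2009, VII.5 Prop. 5.1(b)] -/
theorem splits_nodal_of_hasSplitMultiplicativeReductionAtPrime
    (h : V.HasSplitMultiplicativeReductionAtPrime p) :
    (letI I := (integralModelInt V).map (Int.castRingHom (ZMod p));
      (Polynomial.C I.c₄ * Polynomial.X ^ 2 + Polynomial.C (I.a₁ * I.c₄) * Polynomial.X
        - Polynomial.C (54 * I.b₆ - 3 * I.b₂ * I.b₄ + I.a₂ * I.c₄)).Splits) := by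
  obtain ⟨hΔ, hc⟩ := dvd_and_not_dvd_c₄_of_hasMultiplicativeReductionAtPrime V p
    h.hasMultiplicativeReductionAtPrime
  obtain ⟨v, hv⟩ : ∃ v : HeightOneSpectrum (𝓞 ℚ), (primesEquiv v : ℕ) = p :=
    ⟨primesEquiv.symm ⟨p, hp.out⟩, by rw [Equiv.apply_symm_apply]⟩
  subst hv
  exact (V.hasSplitMultiplicativeReductionAt_iff_splits v hΔ hc).mp
    ((hasSplitMultiplicativeReductionAtPrime_iff_hasSplitMultiplicativeReductionAt V v).mp h)

variable {K : Type} [Field K] [NumberField K]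

/-- **Split stays split at a place of residue degree one.** For `V/ℚ` globally minimal with SPLIT
multiplicative reduction at `3` and a place `𝔭` of `K` with `3 ∈ 𝔭`, `N(𝔭) = 3` (e.g. `K = ℚ(ζ₃)`,
`𝔭 = (√−3)`): `V_K` has split multiplicative reduction at `𝔭` (model independence for the chosen minimal
model of `V_K ⊗ K_𝔭` versus the minimal equation `V_ℤ ⊗ 𝒪_𝔭`; its node-tangent quadratic is that of
`V_ℤ` mapped to `k_𝔭 ≃ ℤ/3`, where it splits). Twin of
`not_hasSplitMultiplicativeReductionAt_baseChange_of_not_split`.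
[cite: SilvermanAEC2009, VII.5 Prop. 5.1(b) and VII.1 Prop. 1.3(b)] -/
theorem hasSplitMultiplicativeReductionAt_baseChange_of_split (𝔭 : HeightOneSpectrum (𝓞 K))
    (h3 : ((3 : ℕ) : 𝓞 K) ∈ 𝔭.asIdeal) (hN : Ideal.absNorm 𝔭.asIdeal = 3)
    (hsplit : V.HasSplitMultiplicativeReductionAtPrime 3) :
    (V.baseChange K).HasSplitMultiplicativeReductionAt 𝔭 := by
  have hmult : V.HasMultiplicativeReductionAtPrime 3 := hsplit.hasMultiplicativeReductionAtPrime
  set R := 𝔭.adicCompletionIntegers K with hR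
  set X : WeierstrassCurve (𝔭.adicCompletion K) := (V.baseChange K).baseChange (𝔭.adicCompletion K)
    with hX
  obtain ⟨hminK, hmultK⟩ :=
    isMinimalAt_and_hasMultiplicativeReductionAt_baseChange_of_mult V (p := 3) hmult 𝔭 h3
  haveI hmin : X.IsMinimal R := hminK
  have hΔX : X.Δ ≠ 0 := by
    rw [hX, baseChange, map_Δ, baseChange, map_Δ]
    refine (map_ne_zero _).mpr ((map_ne_zero _).mpr V.isUnit_Δ.ne_zero)
  obtain ⟨D, hD⟩ : ∃ D : VariableChange (𝔭.adicCompletion K),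
      (V.baseChange K).localMinimalModel 𝔭 = D • X := ⟨_, rfl⟩
  have hmultX : X.HasMultiplicativeReduction R := by
    have h := hmultK
    unfold HasMultiplicativeReductionAt at h
    rw [hD, hasMultiplicativeReduction_iff_of_isMinimal_of_eq_smul R rfl hΔX] at h
    exact h
  -- the integral model of `X` is `V_ℤ ⊗ 𝒪_𝔭`
  have h2 : X.integralModel R = (integralModelInt V).map (Int.castRingHom R) := by
    refine integralModel_eq_of_baseChange_eq _ _ ?_
    rw [hX]
    conv_rhs => rw [← map_integralModelInt V]
    rw [baseChange, baseChange, baseChange, map_map, map_map, map_map]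
    exact congrArg (integralModelInt V).map (RingHom.ext_int _ _)
  -- the residue field has three elements
  have hk : Nat.card (IsLocalRing.ResidueField R) = 3 :=
    natCard_residueField_adicCompletionIntegers_eq_three 𝔭 hN
  haveI : Finite (IsLocalRing.ResidueField R) := Nat.finite_of_card_ne_zero (by rw [hk]; norm_num)
  letI : Fintype (IsLocalRing.ResidueField R) := Fintype.ofFinite _
  have hcard : Fintype.card (IsLocalRing.ResidueField R) = 3 := by rw [Fintype.card_eq_nat_card, hk]
  let e : ZMod 3 ≃+* IsLocalRing.ResidueField R :=
    ZMod.ringEquivOfPrime (IsLocalRing.ResidueField R) Nat.prime_three hcard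
  have hs3 := splits_nodal_of_hasSplitMultiplicativeReductionAtPrime V 3 hsplit
  have hring : (algebraMap R (IsLocalRing.ResidueField R)).comp (Int.castRingHom R) =
      (e : ZMod 3 →+* IsLocalRing.ResidueField R).comp (Int.castRingHom (ZMod 3)) :=
    RingHom.ext_int _ _
  haveI : (D • X).IsMinimal R := by rw [← hD]; exact instIsMinimalLocalMinimalModel 𝔭 (V.baseChange K)
  unfold HasSplitMultiplicativeReductionAt
  rw [hD, hasSplitMultiplicativeReduction_iff_of_isMinimal_of_eq_smul R rfl hΔX,
    hasSplitMultiplicativeReduction_iff]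
  refine ⟨hmultX, ?_⟩
  rw [h2, nodalTangents_map, Polynomial.map_map, hring, ← Polynomial.map_map,
    splits_map_ringEquiv_iff e, ← nodalTangents_map]
  exact hs3

end Split

/-! ## §2 `[K_𝔭 : ℚ₃] = e·f = 2·1` is prime to `3` for `K = ℚ(ζ₃)` -/

section Degree

variable (K : Type) [Field K] [NumberField K] [hK : IsCyclotomicExtension {3} ℚ K]

/-- For `K = ℚ(ζ₃)` and the prime `𝔭` above `3`: `e(𝔭|3) = 2`, `f(𝔭|3) = 1`, so `3 ∤ e·f = [K_𝔭 : ℚ₃]`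
(Mathlib: `IsCyclotomicExtension.Rat.ramificationIdx_eq_of_prime`, `inertiaDeg_eq_of_prime`) — the
degree hypothesis of `Greenberg1999.thm41Analogue_charValue_rankZero_split_baseChange` at `𝔭`. [folklore] -/
theorem not_dvd_ramificationIdx_mul_inertiaDeg_cyclotomicThree (𝔭 : HeightOneSpectrum (𝓞 K))
    (h3 : ((3 : ℕ) : 𝓞 K) ∈ 𝔭.asIdeal) :
    ¬ 3 ∣ 𝔭.asIdeal.ramificationIdx ℤ * 𝔭.asIdeal.inertiaDeg ℤ := by
  haveI : Fact (Nat.Prime 3) := ⟨Nat.prime_three⟩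
  haveI : 𝔭.asIdeal.LiesOver (Ideal.span {((3 : ℕ) : ℤ)}) :=
    Ideal.liesOver_span_of_natCast_mem' Nat.prime_three h3
  rw [IsCyclotomicExtension.Rat.ramificationIdx_eq_of_prime 3 K 𝔭.asIdeal,
    IsCyclotomicExtension.Rat.inertiaDeg_eq_of_prime 3 K 𝔭.asIdeal]
  norm_num

end Degree

/-! ## §3 `ord₃ log₃ γ_cyc = 1` -/

section Log

/-- **`ord₃ log₃(γ_cyc) = 1`** for the topological generator `γ_cyc = 1 + 3 = 4` of `1 + 3ℤ₃`
(`cyclotomicGenerator 3`): `log₃ 4 = L(4)` with `‖L(y)‖ = ‖1 − y‖` for `‖1 − y‖ < ‖2‖₃ = 1` (tree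
`padicLog_eq_padicLogSeries`, `norm_padicLogSeries_eq`), and `‖1 − 4‖₃ = 3⁻¹`. [cite: Washington1997, §5.1 (p-adic logarithm)] -/
theorem valuation_padicLog_cyclotomicGenerator_three :
    (padicLog 3 (cyclotomicGenerator 3 : ℚ_[3])).valuation = 1 := by
  haveI : Fact (Nat.Prime 3) := ⟨Nat.prime_three⟩
  have hγ : (cyclotomicGenerator 3 : ℚ_[3]) = 4 := by
    rw [cyclotomicGenerator, cyclotomicExponent]; norm_num
  have h13 : (1 : ℚ_[3]) - 4 = -(3 : ℚ_[3]) := by norm_num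
  have hn3 : ‖(1 : ℚ_[3]) - 4‖ = (3 : ℝ)⁻¹ := by
    rw [h13, norm_neg]
    have h := Padic.norm_p (p := 3)
    exact_mod_cast h
  have h2 : ‖(2 : ℚ_[3])‖ = 1 := by
    have hle : ‖((2 : ℤ) : ℚ_[3])‖ ≤ 1 := Padic.norm_int_le_one 2
    have hnlt : ¬ ‖((2 : ℤ) : ℚ_[3])‖ < 1 := by
      rw [Padic.norm_intCast_lt_one_iff]; norm_num
    have h : ‖((2 : ℤ) : ℚ_[3])‖ = 1 := le_antisymm hle (not_lt.mp hnlt)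
    exact_mod_cast h
  have hlt1 : ‖(1 : ℚ_[3]) - 4‖ < 1 := by rw [hn3]; norm_num
  have hlt2 : ‖(1 : ℚ_[3]) - 4‖ < ‖(2 : ℚ_[3])‖ := by rw [h2]; exact hlt1
  rw [hγ, padicLog_eq_padicLogSeries hlt1]
  have hne : padicLogSeries 3 (4 : ℚ_[3]) ≠ 0 := by
    intro h0
    have := norm_padicLogSeries_eq hlt2
    rw [h0, norm_zero, hn3] at this
    norm_num at this
  refine valuation_eq_of_norm_eq hne (n := 1) ?_
  rw [norm_padicLogSeries_eq hlt2, hn3, zpow_neg, zpow_one]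
  norm_num

end Log

end Summit.BirchSwinnertonDyer.Rank1Residual.Additive

end
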